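import Mathlib.Analysis.InnerProductSpace.ProdL2
import Mathlib.Analysis.InnerProductSpace.Dual
import Mathlib.Analysis.InnerProductSpace.Convex
import Mathlib.Analysis.Convex.Hull
import Mathlib.Analysis.Convex.Exposed
import Mathlib.Analysis.Convex.Join
import Mathlib.Analysis.Convex.StrictConvexSpace
import Mathlib.Analysis.Normed.Affine.AddTorsor
import Mathlib.LinearAlgebra.AffineSpace.Independent
import Mathlib.LinearAlgebra.Basis.Basic
import Mathlib.LinearAlgebra.Basis.VectorSpace
import Mathlib.Topology.Algebra.Module.FiniteDimension
import Literature.Probability.LatticeModels.DelaunayGraph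
import HarnessLib

/-!
# The Möbius–Delaunay graph of a point configuration: bridge, similarity equivariance, Brown's lift

Definition request `defn-moebiusDelaunayGraph` (route
`CriticalPhenomena/Ising3DConformalLimit/ConformalPoissonDevice`, D1). The notion itself —
the **pencil rule** `IsMoebiusDelaunayPair ω p q` (some non-zero sphere-or-hyperplane form
`Q z = a‖z‖² + ⟪b, z⟫ + c` vanishes at `p`, `q` and is `≥ 0` on `ω`) and the graph
`moebiusDelaunayGraph ω : SimpleGraph ↥ω` — already lives in
`Literature.Probability.LatticeModels` (file `Literature/Probability/LatticeModels/DelaunayGraph.lean`,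
together with `delaunayGraph_le_moebiusDelaunayGraph`, `moebiusDelaunayGraph_eq_delaunayGraph` for
unconfined configurations and the inversion symmetry `moebiusDelaunayGraphInversionIso`). It is NOT
redeclared here. This file supplies what the request asks for on top of it:

* `PointConfig.moebiusDelaunayGraph ξ` — the graph of a locally finite point configuration (the
  carrier of the `IsPoissonPointProcess` laws of the device routes), and
  `fromRelMoebiusDelaunayIso` identifying the graph written inline in the route
  (`SimpleGraph.fromRel` of the pencil relation on `↥h.toFinset`, `h : (ω : Set E).Finite`) with
  `moebiusDelaunayGraph ω`;
* **similarity equivariance** (`isMoebiusDelaunayPair_similarity_iff`,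
  `moebiusDelaunayGraphSimilarityIso`): `x ↦ c • R x + v` (`c ≠ 0`, `R` a linear isometry
  equivalence) maps the Möbius–Delaunay graph of `ω` isomorphically onto that of its image — pencil
  forms pull back to pencil forms (`pencil_similarity`);
* **Brown's stereographic lift** (Brown 1979 lifts the sites to a sphere by inversion and reads the
  Voronoi/Delaunay structure off the convex hull; Boissonnat–Yvinec 1998 use the paraboloid,
  §17.2.2–17.2.3, Lemma 17.2.2, Thm 17.3.1, which is projectively equivalent to the sphere, §7.3,
  and credit Brown in §17.6; Edelsbrunner 2001, §5.1): `stereoLift : F → WithLp 2 (F × ℝ)`,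
  `𝓛 z = (2z, ‖z‖² − 1) / (1 + ‖z‖²)`, the inverse stereographic projection onto the unit sphere of
  `F × ℝ` from its north pole `(0, 1)` (`norm_stereoLift`, `stereoLift_injective`). Affine
  functions `w ↦ ⟪n, w⟫ + δ` upstairs restrict along the lift to `(1 + ‖z‖²)⁻¹ · (pencil form)`
  (`inner_stereoLift_add`, the spherical form of Lemma 17.2.2), whence
  `isMoebiusDelaunayPair_iff_stereoLift` / `isMoebiusDelaunayPair_iff_convexHull_stereoLift`:
  `p ~ q` iff `𝓛 p`, `𝓛 q` lie on a common supporting hyperplane of the convex hull of the lifted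
  configuration, i.e. in a common proper face of that convex body (every `ω`, any dimension);
* **the 1-skeleton theorem** (requested form of (i)): for a finite configuration in
  `SphericalGeneralPosition` (lifts of sites on a common sphere-or-hyperplane affinely
  independent — for `ω ⊂ ℝ³`: no 4 cocircular-or-collinear, no 5 cospherical-or-coplanar sites,
  a.s. for Poisson samples) and `F` finite-dimensional,
  `moebiusDelaunayGraph_adj_iff_isExposed`: distinct sites are adjacent iff the segment between
  their lifts is an exposed face (edge) of the inscribed polytope `conv (𝓛 '' ω)`
  (`IsMoebiusDelaunayPair.isExposed_segment_stereoLift`; the converse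
  `isMoebiusDelaunayPair_of_isExposed_segment` needs no general position). Ingredients proved
  here: the face lemma `sep_convexHull_eq_convexHull_sep` (a supporting hyperplane cuts `conv S`
  in `conv` of the sites on it) and a perturbation of the supporting functional;
* **the unit inversion upstairs** is the reflection in the equatorial hyperplane
  (`stereoLift_inversion`), and linear isometries of `F` act by `(y, t) ↦ (R y, t)`
  (`stereoLift_linearIsometryEquiv`): both permute supporting hyperplanes — the geometric content
  of `moebiusDelaunayGraphInversionIso` and of the `O(4)`-symmetry of the `S³` device;
* the ambient-vertex form `(moebiusDelaunayGraph ω).spanningCoe : SimpleGraph F` of the request's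
  informal signature (`spanningCoe_moebiusDelaunayGraph_adj`; Mathlib's `SimpleGraph.spanningCoe`,
  `SimpleGraph.induce_spanningCoe`).

## Design notes

* Local finiteness (request (iii)): the device configurations are a.s. finite (the intensity
  `N(1+‖z‖²)⁻³dz` has finite mass), covered by `instLocallyFiniteMoebiusDelaunayGraph`. For an
  INFINITE locally finite `ω`, even in general position, the (Möbius–)Delaunay graph need not be
  locally finite (design note in `DelaunayGraph.lean`; the correct criterion is boundedness of
  Voronoi cells, `locallyFiniteOfVoronoiCell`), so no such lemma is stated.
* The weak rule makes the graph of a configuration contained in ONE sphere-or-hyperplane complete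
  (that form itself is a witness for every pair); excluded by general position as soon as
  `ω ⊂ ℝᵈ` has `d + 2` sites, and irrelevant for the a.s. general-position inputs.
* Everything is stated over a real inner product space `F` (finite-dimensional for the 1-skeleton
  theorem, where Riesz representation and automatic continuity are used); the route uses
  `F = EuclideanSpace ℝ (Fin 3)`.
* The file sits in `Literature/Analysis/FunctionSpaces` (the topic of the request), next to
  `PointConfig` / `IsPoissonPointProcess` which carry the device laws; the graph itself stays in
  `Literature.Probability.LatticeModels` and dot-notation extensions of `IsMoebiusDelaunayPair` are
  declared with their absolute names.

## References

* K. Q. Brown, *Voronoi diagrams from convex hulls*, Inform. Process. Lett. 9 (1979) 223–228.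
* J.-D. Boissonnat, M. Yvinec, *Algorithmic Geometry*, CUP 1998, §7.3 (polarity; sphere and
  paraboloid projectively equivalent), §17.2.2–17.2.3 (the lifting map), Lemma 17.2.2, Thm 17.3.1
  (Delaunay complex = projected lower hull of the lift), §17.6 (notes: Brown, Edelsbrunner–Seidel),
  §18.5.1 (pencils of spheres).
* H. Edelsbrunner, *Geometry and Topology for Mesh Generation*, CUP 2001, §1.2 (Lifted Circle
  Claim), §5.1 (Delaunay tetrahedrization as projected boundary complex of a polyhedron in `ℝ⁴`).
-/

noncomputable section

open Metric Set Function EuclideanGeometry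

namespace Literature.Analysis.FunctionSpaces

open Literature.Probability.LatticeModels

variable {F : Type*} [NormedAddCommGroup F] [InnerProductSpace ℝ F]

/-! ### Bridge to point configurations and to the inline graph of the route -/

/-- The Möbius–Delaunay (pencil-rule) graph of a locally finite point configuration: the
`moebiusDelaunayGraph` of its set of points. Declared in the `PointConfig` namespace for dot
notation `ξ.moebiusDelaunayGraph`. [cite: BoissonnatYvinec1998, §17.2 and Thm 17.3.4] -/
abbrev PointConfig.moebiusDelaunayGraph (ξ : PointConfig F) : SimpleGraph ↥(ξ : Set F) :=
  Literature.Probability.LatticeModels.moebiusDelaunayGraph (ξ : Set F)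

/-- Unfolding of `PointConfig.moebiusDelaunayGraph`. [folklore] -/
theorem PointConfig.moebiusDelaunayGraph_adj (ξ : PointConfig F) {p q : ↥(ξ : Set F)} :
    ξ.moebiusDelaunayGraph.Adj p q ↔ p ≠ q ∧ IsMoebiusDelaunayPair (ξ : Set F) (p : F) (q : F) :=
  Iff.rfl

/-- The Delaunay graph of a configuration is a subgraph of its Möbius–Delaunay graph. [folklore] -/
theorem PointConfig.delaunayGraph_le_moebiusDelaunayGraph (ξ : PointConfig F) :
    ξ.delaunayGraph ≤ ξ.moebiusDelaunayGraph :=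
  Literature.Probability.LatticeModels.delaunayGraph_le_moebiusDelaunayGraph _

/-- The adjacency of the graph written inline in route `ConformalPoissonDevice`:
`SimpleGraph.fromRel` of the pencil relation on the finset of sites of a finite configuration
(the inline relation `∃ a c b, (a ≠ 0 ∨ b ≠ 0 ∨ c ≠ 0) ∧ …` is `IsMoebiusDelaunayPair ω p q` by
`rfl`). Since the pencil relation is symmetric, `fromRel` just removes the diagonal. [folklore] -/
theorem fromRel_isMoebiusDelaunayPair_adj {ω : Set F} (h : ω.Finite) {p q : ↥h.toFinset} :
    (SimpleGraph.fromRel fun p q : ↥h.toFinset => IsMoebiusDelaunayPair ω (p : F) (q : F)).Adj p q ↔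
      p ≠ q ∧ IsMoebiusDelaunayPair ω (p : F) (q : F) := by
  rw [SimpleGraph.fromRel_adj]
  exact and_congr_right fun _ => ⟨fun h' => h'.elim id IsMoebiusDelaunayPair.symm, Or.inl⟩

/-- The inline graph of route `ConformalPoissonDevice` on `↥h.toFinset` IS the Möbius–Delaunay
graph `moebiusDelaunayGraph ω` on `↥ω`, along the identity equivalence
`↥h.toFinset ≃ ↥ω`. [folklore] -/
def fromRelMoebiusDelaunayIso {ω : Set F} (h : ω.Finite) :
    (SimpleGraph.fromRel fun p q : ↥h.toFinset => IsMoebiusDelaunayPair ω (p : F) (q : F)) ≃g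
      moebiusDelaunayGraph ω where
  toEquiv := h.subtypeEquivToFinset.symm
  map_rel_iff' := by
    intro p q
    rw [moebiusDelaunayGraph_adj, fromRel_isMoebiusDelaunayPair_adj]
    simp only [Set.Finite.subtypeEquivToFinset, Equiv.subtypeEquiv_symm, Equiv.refl_symm,
      Equiv.subtypeEquiv_apply, Equiv.coe_refl, id_eq, ne_eq, Subtype.mk.injEq]
    exact Iff.rfl.and Iff.rfl |>.trans (by rw [← Subtype.ext_iff])

/-! ### Similarity equivariance of the pencil rule -/

/-- Pencil forms pull back to pencil forms under similarities `x ↦ c • R x + v`: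
`a‖c R x + v‖² + ⟪b, c R x + v⟫ + c₀ = (a c²)‖x‖² + ⟪c R⁻¹(2a v + b), x⟫ + (a‖v‖² + ⟪b, v⟫ + c₀)`.
[folklore] -/
theorem pencil_similarity (a c₀ : ℝ) (b : F) (c : ℝ) (R : F ≃ₗᵢ[ℝ] F) (v x : F) :
    a * ‖c • R x + v‖ ^ 2 + inner ℝ b (c • R x + v) + c₀ =
      a * c ^ 2 * ‖x‖ ^ 2 + inner ℝ (c • R.symm ((2 * a) • v + b)) x +
        (a * ‖v‖ ^ 2 + inner ℝ b v + c₀) := by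
  have h1 : inner ℝ (R x) v = inner ℝ (R.symm v) x := by
    rw [LinearIsometryEquiv.inner_map_eq_flip, real_inner_comm]
  have h2 : inner ℝ b (R x) = inner ℝ (R.symm b) x := by
    rw [real_inner_comm, LinearIsometryEquiv.inner_map_eq_flip, real_inner_comm]
  rw [norm_add_sq_real, norm_smul, mul_pow, Real.norm_eq_abs, sq_abs, LinearIsometryEquiv.norm_map,
    real_inner_smul_left, h1, inner_add_right, real_inner_smul_right, h2, map_add,
    LinearIsometryEquiv.map_smul, real_inner_smul_left, inner_add_left, real_inner_smul_left]
  ring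

/-- A pencil witness for the image of `ω` under a similarity pulls back to a pencil witness for
`ω`. [folklore] -/
theorem _root_.Literature.Probability.LatticeModels.IsMoebiusDelaunayPair.of_similarity
    {ω : Set F} {p q : F} {c : ℝ} (hc : c ≠ 0) (R : F ≃ₗᵢ[ℝ] F) (v : F)
    (h : IsMoebiusDelaunayPair ((fun x => c • R x + v) '' ω) (c • R p + v) (c • R q + v)) :
    IsMoebiusDelaunayPair ω p q := by
  obtain ⟨a, c₀, b, hne, hp, hq, hω⟩ := h
  refine ⟨a * c ^ 2, a * ‖v‖ ^ 2 + inner ℝ b v + c₀, c • R.symm ((2 * a) • v + b), ?_, ?_, ?_, ?_⟩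
  · by_contra hcon
    simp only [not_or, not_not] at hcon
    obtain ⟨h₁, h₂, h₃⟩ := hcon
    have ha : a = 0 := by
      rcases mul_eq_zero.1 h₁ with h | h
      · exact h
      · exact absurd (pow_eq_zero_iff two_ne_zero |>.1 h) hc
    have hb : b = 0 := by
      rw [ha, mul_zero, zero_smul, zero_add, smul_eq_zero] at h₂
      simpa using h₂.resolve_left hc
    have hc₀ : c₀ = 0 := by simpa [ha, hb] using h₃
    exact hne.elim (fun h => h ha) fun h => h.elim (fun h => h hb) fun h => h hc₀
  · rw [← pencil_similarity, hp]
  · rw [← pencil_similarity, hq]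
  · intro z hz
    rw [← pencil_similarity]
    exact hω _ ⟨z, hz, rfl⟩

/-- **Similarity equivariance of the pencil rule**: for `c ≠ 0`, a linear isometry equivalence
`R` and `v`, the similarity `x ↦ c • R x + v` preserves Möbius–Delaunay adjacency (both
directions: the inverse map is again a similarity). [folklore] -/
theorem isMoebiusDelaunayPair_similarity_iff {ω : Set F} {p q : F} {c : ℝ} (hc : c ≠ 0)
    (R : F ≃ₗᵢ[ℝ] F) (v : F) :
    IsMoebiusDelaunayPair ((fun x => c • R x + v) '' ω) (c • R p + v) (c • R q + v) ↔
      IsMoebiusDelaunayPair ω p q := by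
  refine ⟨fun h => h.of_similarity hc R v, fun h => ?_⟩
  have hg : ∀ x, c⁻¹ • R.symm (c • R x + v) + -(c⁻¹ • R.symm v) = x := fun x => by
    rw [map_add, LinearIsometryEquiv.map_smul, R.symm_apply_apply, smul_add, smul_smul,
      inv_mul_cancel₀ hc, one_smul, add_neg_cancel_right]
  refine IsMoebiusDelaunayPair.of_similarity (inv_ne_zero hc) R.symm (-(c⁻¹ • R.symm v)) ?_
  rw [Set.image_image, hg, hg]
  convert h
  exact (congrArg (· '' ω) (funext hg)).trans (Set.image_id' ω)

/-- **Similarity equivariance of the Möbius–Delaunay graph**: `x ↦ c • R x + v` (`c ≠ 0`, `R` a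
linear isometry equivalence — rotations/reflections, with dilations and translations) induces
`moebiusDelaunayGraph ω ≃g moebiusDelaunayGraph (image)`. [folklore] -/
def moebiusDelaunayGraphSimilarityIso (ω : Set F) {c : ℝ} (hc : c ≠ 0) (R : F ≃ₗᵢ[ℝ] F)
    (v : F) : moebiusDelaunayGraph ω ≃g moebiusDelaunayGraph ((fun x => c • R x + v) '' ω) where
  toEquiv := Equiv.Set.image _ ω (bijective_similarity hc R v).1
  map_rel_iff' := by
    intro p q
    simp only [moebiusDelaunayGraph_adj, Equiv.Set.image_apply, Ne, Subtype.mk.injEq,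
      (bijective_similarity hc R v).1.eq_iff, Subtype.coe_inj,
      isMoebiusDelaunayPair_similarity_iff hc]

/-! ### Brown's stereographic lift -/

omit [InnerProductSpace ℝ F] in
/-- `1 + ‖z‖² > 0`. [folklore] -/
theorem one_add_norm_sq_pos (z : F) : 0 < 1 + ‖z‖ ^ 2 := by positivity

/-- **Brown's stereographic lift** `𝓛 : F → F × ℝ` (Euclidean norm upstairs):
`𝓛 z = ((2 / (1 + ‖z‖²)) z, (‖z‖² − 1) / (1 + ‖z‖²))`, the inverse of the stereographic
projection of the unit sphere of `F × ℝ` from its north pole `(0, 1)` onto the equatorial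
hyperplane `F × {0}`. Spheres and hyperplanes of `F` are exactly the pull-backs of hyperplane
sections of the sphere (Brown 1979 lifts to a sphere by inversion; Boissonnat–Yvinec 1998 lift to
the paraboloid, §17.2.3, projectively equivalent to the sphere, §7.3, crediting Brown in §17.6).
[cite: BoissonnatYvinec1998, §17.2.3 and §7.3] -/
def stereoLift (z : F) : WithLp 2 (F × ℝ) :=
  WithLp.toLp 2 ((2 / (1 + ‖z‖ ^ 2)) • z, (‖z‖ ^ 2 - 1) / (1 + ‖z‖ ^ 2))

/-- First component of the lift. [folklore] -/
@[simp] theorem stereoLift_fst (z : F) : (stereoLift z).fst = (2 / (1 + ‖z‖ ^ 2)) • z := rfl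

/-- Last component (height) of the lift. [folklore] -/
@[simp] theorem stereoLift_snd (z : F) :
    (stereoLift z).snd = (‖z‖ ^ 2 - 1) / (1 + ‖z‖ ^ 2) := rfl

/-- The lift lands on the unit sphere of `F × ℝ`. [cite: BoissonnatYvinec1998, §7.3 and §17.2.3] -/
theorem norm_stereoLift (z : F) : ‖stereoLift z‖ = 1 := by
  have h := one_add_norm_sq_pos z
  have hsq : ‖stereoLift z‖ ^ 2 = 1 := by
    rw [WithLp.prod_norm_sq_eq_of_L2, stereoLift_fst, stereoLift_snd, norm_smul, mul_pow,
      Real.norm_eq_abs, sq_abs, Real.norm_eq_abs, sq_abs]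
    field_simp
    ring
  exact (pow_eq_one_iff_of_nonneg (norm_nonneg _) two_ne_zero).1 hsq

/-- The lift lands in the unit sphere. [cite: BoissonnatYvinec1998, §7.3 and §17.2.3] -/
theorem stereoLift_mem_sphere (z : F) : stereoLift z ∈ sphere (0 : WithLp 2 (F × ℝ)) 1 := by
  rw [mem_sphere_zero_iff_norm, norm_stereoLift]

/-- The lift misses the north pole: its height is `< 1`. [folklore] -/
theorem stereoLift_snd_lt_one (z : F) : (stereoLift z).snd < 1 := by
  rw [stereoLift_snd, div_lt_one (one_add_norm_sq_pos z)]
  linarith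

/-- `1 − height = 2 / (1 + ‖z‖²)`. [folklore] -/
theorem one_sub_stereoLift_snd (z : F) : 1 - (stereoLift z).snd = 2 / (1 + ‖z‖ ^ 2) := by
  have h := (one_add_norm_sq_pos z).ne'
  rw [stereoLift_snd]
  field_simp
  ring

/-- Stereographic projection from the north pole inverts the lift: `z = (1 − t)⁻¹ y` for
`𝓛 z = (y, t)`. [folklore] -/
theorem inv_one_sub_snd_smul_stereoLift_fst (z : F) :
    (1 - (stereoLift z).snd)⁻¹ • (stereoLift z).fst = z := by
  rw [one_sub_stereoLift_snd, stereoLift_fst, smul_smul, inv_mul_cancel₀, one_smul]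
  exact div_ne_zero two_ne_zero (one_add_norm_sq_pos z).ne'

/-- The lift is injective. [folklore] -/
theorem stereoLift_injective : Injective (stereoLift : F → WithLp 2 (F × ℝ)) := fun x y h => by
  rw [← inv_one_sub_snd_smul_stereoLift_fst x, h, inv_one_sub_snd_smul_stereoLift_fst]

/-- **Brown's identity**: an affine function `w ↦ ⟪n, w⟫ + δ` of `F × ℝ` restricts along the
lift to `(1 + ‖z‖²)⁻¹` times the pencil form with coefficients
`(a, b, c) = (n₂ + δ, 2 n₁, δ − n₂)`; hyperplane sections of the sphere are the spheres and
hyperplanes of `F` (the spherical form, via §7.3, of Boissonnat–Yvinec 1998, Lemma 17.2.2).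
[cite: BoissonnatYvinec1998, Lemma 17.2.2 and §7.3] -/
theorem inner_stereoLift_add (n : WithLp 2 (F × ℝ)) (δ : ℝ) (z : F) :
    inner ℝ n (stereoLift z) + δ =
      (1 + ‖z‖ ^ 2)⁻¹ * ((n.snd + δ) * ‖z‖ ^ 2 + inner ℝ ((2 : ℝ) • n.fst) z + (δ - n.snd)) := by
  have h := (one_add_norm_sq_pos z).ne'
  rw [WithLp.prod_inner_apply, WithLp.ofLp_fst, WithLp.ofLp_snd, WithLp.ofLp_fst, WithLp.ofLp_snd,
    stereoLift_fst, stereoLift_snd, real_inner_smul_right, real_inner_smul_left, RCLike.inner_apply,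
    RCLike.conj_to_real]
  field_simp
  ring

/-- **Brown's theorem, supporting-hyperplane form.** `p ~ q` in the pencil rule iff the lifted
points `𝓛 p`, `𝓛 q` lie on a common hyperplane `{w | ⟪n, w⟫ + δ = 0}` (`n ≠ 0`) of `F × ℝ` whose
closed half-space `{w | 0 ≤ ⟪n, w⟫ + δ}` contains the lifted configuration (Brown 1979;
Boissonnat–Yvinec 1998, Lemma 17.2.2 and Thm 17.3.1 for the paraboloid, §17.6 for the attribution).
[cite: BoissonnatYvinec1998, Lemma 17.2.2 and Thm 17.3.1] -/
theorem isMoebiusDelaunayPair_iff_stereoLift {ω : Set F} {p q : F} :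
    IsMoebiusDelaunayPair ω p q ↔ ∃ (n : WithLp 2 (F × ℝ)) (δ : ℝ), n ≠ 0 ∧
      inner ℝ n (stereoLift p) + δ = 0 ∧ inner ℝ n (stereoLift q) + δ = 0 ∧
      ∀ z ∈ ω, 0 ≤ inner ℝ n (stereoLift z) + δ := by
  constructor
  · rintro ⟨a, c, b, hne, hp, hq, hω⟩
    refine ⟨WithLp.toLp 2 ((2 : ℝ)⁻¹ • b, (a - c) / 2), (a + c) / 2, ?_, ?_, ?_, fun z hz => ?_⟩
    · intro hn
      rw [WithLp.toLp_eq_zero, Prod.mk_eq_zero, smul_eq_zero] at hn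
      obtain ⟨hb, hac⟩ := hn
      have hb : b = 0 := hb.resolve_left (by norm_num)
      have hac : a = c := by linarith [div_eq_zero_iff.1 hac |>.resolve_right two_ne_zero]
      have ha : a = 0 := by
        rw [hb, inner_zero_left, add_zero, ← hac] at hp
        have : a * (‖p‖ ^ 2 + 1) = 0 := by linarith
        exact (mul_eq_zero.1 this).resolve_right (by positivity)
      exact hne.elim (fun h => h ha) fun h => h.elim (fun h => h hb) fun h => h (hac ▸ ha)
    all_goals
      rw [inner_stereoLift_add, WithLp.toLp_snd, WithLp.toLp_fst, smul_smul,
        mul_inv_cancel₀ (two_ne_zero (α := ℝ)), one_smul]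
    · rw [show (a - c) / 2 + (a + c) / 2 = a by ring, show (a + c) / 2 - (a - c) / 2 = c by ring, hp,
        mul_zero]
    · rw [show (a - c) / 2 + (a + c) / 2 = a by ring, show (a + c) / 2 - (a - c) / 2 = c by ring, hq,
        mul_zero]
    · rw [show (a - c) / 2 + (a + c) / 2 = a by ring, show (a + c) / 2 - (a - c) / 2 = c by ring]
      exact mul_nonneg (inv_nonneg.2 (one_add_norm_sq_pos z).le) (hω z hz)
  · rintro ⟨n, δ, hn, hp, hq, hω⟩
    refine ⟨n.snd + δ, δ - n.snd, (2 : ℝ) • n.fst, ?_, ?_, ?_, fun z hz => ?_⟩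
    · by_contra hcon
      simp only [not_or, not_not] at hcon
      obtain ⟨h₁, h₂, h₃⟩ := hcon
      apply hn
      have hfst : n.fst = 0 := (smul_eq_zero.1 h₂).resolve_left two_ne_zero
      have hsnd : n.snd = 0 := by linarith
      rw [WithLp.ext_iff]
      exact Prod.ext hfst hsnd
    · have h := inner_stereoLift_add n δ p
      rw [hp, eq_comm, mul_eq_zero] at h
      exact h.resolve_left (inv_ne_zero (one_add_norm_sq_pos p).ne')
    · have h := inner_stereoLift_add n δ q
      rw [hq, eq_comm, mul_eq_zero] at h
      exact h.resolve_left (inv_ne_zero (one_add_norm_sq_pos q).ne')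
    · have h := inner_stereoLift_add n δ z
      have h0 := hω z hz
      rw [h] at h0
      exact le_of_mul_le_mul_left (by simpa using h0) (inv_pos.2 (one_add_norm_sq_pos z))

/-- The closed half-space `{w | 0 ≤ ⟪n, w⟫ + δ}` is convex. [folklore] -/
theorem convex_halfSpace_inner_add (n : WithLp 2 (F × ℝ)) (δ : ℝ) :
    Convex ℝ {w : WithLp 2 (F × ℝ) | 0 ≤ inner ℝ n w + δ} := by
  have : {w : WithLp 2 (F × ℝ) | 0 ≤ inner ℝ n w + δ} = {w | -δ ≤ innerₗ (WithLp 2 (F × ℝ)) n w} := by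
    ext w; simp only [mem_setOf_eq, innerₗ_apply_apply]; constructor <;> intro h <;> linarith
  rw [this]
  exact convex_halfSpace_ge (innerₗ (WithLp 2 (F × ℝ)) n).isLinear _

/-- **Brown's theorem, convex-hull form**: `p ~ q` in the pencil rule iff `𝓛 p` and `𝓛 q` lie on a
common supporting hyperplane of the convex hull of the lifted configuration `𝓛 '' ω` — i.e. in a
common proper face of that convex body; for finite `ω` in general position (all faces simplices)
this says that `[𝓛 p, 𝓛 q]` is an edge of the inscribed polytope `conv (𝓛 '' ω)`
(`moebiusDelaunayGraph_adj_iff_isExposed`; Brown 1979; Boissonnat–Yvinec 1998, Thm 17.3.1;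
Edelsbrunner 2001, §5.1). [cite: BoissonnatYvinec1998, Lemma 17.2.2 and Thm 17.3.1] -/
theorem isMoebiusDelaunayPair_iff_convexHull_stereoLift {ω : Set F} {p q : F} :
    IsMoebiusDelaunayPair ω p q ↔ ∃ (n : WithLp 2 (F × ℝ)) (δ : ℝ), n ≠ 0 ∧
      inner ℝ n (stereoLift p) + δ = 0 ∧ inner ℝ n (stereoLift q) + δ = 0 ∧
      ∀ w ∈ convexHull ℝ (stereoLift '' ω), 0 ≤ inner ℝ n w + δ := by
  rw [isMoebiusDelaunayPair_iff_stereoLift]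
  refine exists_congr fun n => exists_congr fun δ => and_congr_right fun _ =>
    and_congr_right fun _ => and_congr_right fun _ => ⟨fun h => ?_, fun h z hz => ?_⟩
  · exact convexHull_min (by rintro _ ⟨z, hz, rfl⟩; exact h z hz) (convex_halfSpace_inner_add n δ)
  · exact h _ (subset_convexHull ℝ _ ⟨z, hz, rfl⟩)

/-! ### The unit inversion upstairs: reflection in the equator -/

/-- `‖ι z‖ = ‖z‖⁻¹` for the unit inversion `ι = inversion 0 1` and `z ≠ 0`. [folklore] -/
theorem norm_inversion_zero_one {z : F} (hz : z ≠ 0) : ‖inversion (0 : F) 1 z‖ = ‖z‖⁻¹ := by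
  rw [inversion_zero_one_apply, norm_smul, norm_inv, norm_pow, norm_norm]
  have h : ‖z‖ ≠ 0 := norm_ne_zero_iff.2 hz
  field_simp

/-- **Inversion is the equatorial reflection upstairs**: for `z ≠ 0`,
`𝓛 (ι z) = (y, −t)` where `𝓛 z = (y, t)` and `ι = inversion 0 1` is the unit inversion. Hence `ι`
acts on lifted configurations by a linear isometry of `F × ℝ`, permuting supporting hyperplanes —
the geometric content of `moebiusDelaunayGraphInversionIso`. [folklore] -/
theorem stereoLift_inversion {z : F} (hz : z ≠ 0) :
    stereoLift (inversion (0 : F) 1 z) = WithLp.toLp 2 ((stereoLift z).fst, -(stereoLift z).snd) := by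
  have h0 : ‖z‖ ≠ 0 := norm_ne_zero_iff.2 hz
  have h1 := (one_add_norm_sq_pos z).ne'
  rw [stereoLift, norm_inversion_zero_one hz, inversion_zero_one_apply, smul_smul, stereoLift_fst,
    stereoLift_snd]
  congr 2
  · congr 1
    field_simp
    ring
  · field_simp
    ring

/-- Componentwise: the lift of `ι z` has the same equatorial component as the lift of `z` …
[folklore] -/
theorem stereoLift_inversion_fst {z : F} (hz : z ≠ 0) :
    (stereoLift (inversion (0 : F) 1 z)).fst = (stereoLift z).fst := by
  rw [stereoLift_inversion hz, WithLp.toLp_fst]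

/-- … and the opposite height. [folklore] -/
theorem stereoLift_inversion_snd {z : F} (hz : z ≠ 0) :
    (stereoLift (inversion (0 : F) 1 z)).snd = -(stereoLift z).snd := by
  rw [stereoLift_inversion hz, WithLp.toLp_snd]

/-- A linear isometry `R` of `F` (rotation/reflection about the origin) acts upstairs by the linear
isometry `(y, t) ↦ (R y, t)`: `𝓛 (R z) = (R y, t)`. [folklore] -/
theorem stereoLift_linearIsometryEquiv (R : F ≃ₗᵢ[ℝ] F) (z : F) :
    stereoLift (R z) = WithLp.toLp 2 (R (stereoLift z).fst, (stereoLift z).snd) := by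
  rw [stereoLift, LinearIsometryEquiv.norm_map, stereoLift_fst, stereoLift_snd,
    LinearIsometryEquiv.map_smul]

/-! ### General position: the Möbius–Delaunay graph is the 1-skeleton of the lifted polytope -/

/-- **Face lemma**: a closed half-space `{0 ≤ f}` (`f` affine) containing `S` cuts the convex hull
of `S` in the convex hull of the points of `S` on its boundary hyperplane — the face of `conv S`
supported by `{f = 0}`. [folklore] -/
theorem sep_convexHull_eq_convexHull_sep {E' : Type*} [AddCommGroup E'] [Module ℝ E']
    (f : E' →ᵃ[ℝ] ℝ) {S : Set E'} (hS : ∀ w ∈ S, 0 ≤ f w) :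
    {x ∈ convexHull ℝ S | f x = 0} = convexHull ℝ {w ∈ S | f w = 0} := by
  refine Subset.antisymm ?_ (convexHull_min (fun w hw => ⟨subset_convexHull ℝ S hw.1, hw.2⟩)
    ((convex_convexHull ℝ S).inter ((convex_singleton (0 : ℝ)).affine_preimage f)))
  rintro x ⟨hx, hfx⟩
  have hpos : convexHull ℝ {w ∈ S | f w ≠ 0} ⊆ f ⁻¹' Ioi 0 :=
    convexHull_min (fun w hw => (hS w hw.1).lt_of_ne (Ne.symm hw.2)) ((convex_Ioi 0).affine_preimage f)
  by_cases h0 : {w ∈ S | f w = 0}.Nonempty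
  · by_cases h1 : {w ∈ S | f w ≠ 0}.Nonempty
    · have hS' : S = {w ∈ S | f w = 0} ∪ {w ∈ S | f w ≠ 0} := by
        ext w
        simp only [mem_union, mem_setOf_eq]
        tauto
      rw [hS', convexHull_union h0 h1, mem_convexJoin] at hx
      obtain ⟨a, ha, b, hb, θa, θb, -, -, hθ, rfl⟩ := hx
      have hfa : f a = 0 :=
        (convexHull_min (fun w hw => hw.2) ((convex_singleton (0 : ℝ)).affine_preimage f)) ha
      have hfb : 0 < f b := hpos hb
      rw [Convex.combo_affine_apply hθ, hfa, smul_zero, zero_add, smul_eq_mul] at hfx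
      have hθb : θb = 0 := (mul_eq_zero.1 hfx).resolve_right hfb.ne'
      rw [hθb, add_zero] at hθ
      rw [hθb, zero_smul, add_zero, hθ, one_smul]
      exact ha
    · have hS' : {w ∈ S | f w = 0} = S := by
        refine Subset.antisymm (fun w hw => hw.1) fun w hw => ⟨hw, ?_⟩
        by_contra hcon
        exact h1 ⟨w, hw, hcon⟩
      rwa [hS']
  · exfalso
    have : convexHull ℝ S ⊆ f ⁻¹' Ioi 0 := convexHull_min
      (fun w hw => (hS w hw).lt_of_ne fun h => h0 ⟨w, hw, h.symm⟩) ((convex_Ioi 0).affine_preimage f)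
    exact (this hx).ne' hfx

/-- On a finite set where `H > 0`, `H + ε g > 0` for some `ε > 0`. [folklore] -/
theorem exists_pos_forall_add_mul_pos {α : Type*} {D : Set α} (hD : D.Finite) (H g : α → ℝ)
    (hH : ∀ w ∈ D, 0 < H w) : ∃ ε : ℝ, 0 < ε ∧ ∀ w ∈ D, 0 < H w + ε * g w := by
  rcases D.eq_empty_or_nonempty with rfl | hne
  · exact ⟨1, one_pos, fun w hw => hw.elim⟩
  · obtain ⟨w₀, hw₀, hmin⟩ := D.exists_min_image (fun w => H w / (|g w| + 1)) hD hne
    have hε : 0 < H w₀ / (|g w₀| + 1) := div_pos (hH w₀ hw₀) (by positivity)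
    refine ⟨H w₀ / (|g w₀| + 1), hε, fun w hw => ?_⟩
    have h2 : 0 < |g w| + 1 := by positivity
    have h3 : H w₀ / (|g w₀| + 1) * (|g w| + 1) ≤ H w := (le_div_iff₀ h2).1 (hmin w hw)
    have h5 : H w₀ / (|g w₀| + 1) * -|g w| ≤ H w₀ / (|g w₀| + 1) * g w :=
      mul_le_mul_of_nonneg_left (neg_abs_le _) hε.le
    linarith

/-- **General position for Brown's lift**: the lifts of the sites of `ω` lying on a common
hyperplane `{w | ⟪n, w⟫ + δ = 0}` (`n ≠ 0`) of `F × ℝ` — i.e. on a common sphere-or-hyperplane of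
`F` (`inner_stereoLift_add`) — are affinely independent. As affine subspaces upstairs cut the sphere
in the lifts of intersections of spheres and hyperplanes, for `ω ⊂ ℝᵈ` this says: no `k + 3` sites
on a common `k`-dimensional sphere or plane, `k < d` (for `d = 3`: no 4 cocircular-or-collinear and
no 5 cospherical-or-coplanar sites) — almost sure for Poisson samples with a density. It makes every
proper face of the inscribed polytope `conv (𝓛 '' ω)` a simplex. [folklore] -/
def SphericalGeneralPosition (ω : Set F) : Prop :=
  ∀ (n : WithLp 2 (F × ℝ)) (δ : ℝ), n ≠ 0 →
    AffineIndependent ℝ fun z : {z // z ∈ ω ∧ inner ℝ n (stereoLift z) + δ = 0} => stereoLift (z : F)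

/-- General position is inherited by sub-configurations. [folklore] -/
theorem SphericalGeneralPosition.mono {ω ω' : Set F} (h : SphericalGeneralPosition ω') (hsub : ω ⊆ ω') :
    SphericalGeneralPosition ω := fun n δ hn => by
  let e : {z // z ∈ ω ∧ inner ℝ n (stereoLift z) + δ = 0} ↪
      {z // z ∈ ω' ∧ inner ℝ n (stereoLift z) + δ = 0} :=
    ⟨fun z => ⟨z, hsub z.2.1, z.2.2⟩, fun z w hzw => Subtype.ext (Subtype.mk.inj hzw)⟩
  exact (h n δ hn).comp_embedding e

section OneSkeleton

variable [FiniteDimensional ℝ F]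

/-- **Brown's theorem, 1-skeleton form (pencil pair ⇒ edge).** For a finite configuration in
general position, if `p ~ q` in the pencil rule (`p, q ∈ ω`) then the segment `[𝓛 p, 𝓛 q]` is an
exposed face — an edge (a vertex if `p = q`) — of the inscribed polytope `conv (𝓛 '' ω)`: perturb
the supporting hyperplane of `isMoebiusDelaunayPair_iff_stereoLift` by `ε` times an affine function
vanishing at `𝓛 p`, `𝓛 q` and equal to `1` at the other (affinely independent) lifted sites on it
(Brown 1979; Boissonnat–Yvinec 1998, Thm 17.3.1 with Lemma 17.2.2; Edelsbrunner 2001, §5.1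
"Polar polyhedron": the Delaunay tetrahedrization is the projected boundary complex of the lifted
polyhedron). [cite: BoissonnatYvinec1998, Thm 17.3.1] -/
theorem _root_.Literature.Probability.LatticeModels.IsMoebiusDelaunayPair.isExposed_segment_stereoLift
    {ω : Set F} (hfin : ω.Finite) (hgp : SphericalGeneralPosition ω) {p q : F} (hp : p ∈ ω)
    (hq : q ∈ ω) (h : IsMoebiusDelaunayPair ω p q) :
    IsExposed ℝ (convexHull ℝ (stereoLift '' ω)) (segment ℝ (stereoLift p) (stereoLift q)) := by
  classical
  intro _
  obtain ⟨n, δ, hn, hP, hQ, hω⟩ := isMoebiusDelaunayPair_iff_stereoLift.1 h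
  -- the lifted sites on the supporting hyperplane, based at `𝓛 p`, give independent vectors
  set i₁ : {z // z ∈ ω ∧ inner ℝ n (stereoLift z) + δ = 0} := ⟨p, hp, hP⟩ with hi₁
  have hli := (affineIndependent_iff_linearIndependent_vsub ℝ _ i₁).1 (hgp n δ hn)
  -- an affine function vanishing at `𝓛 p`, `𝓛 q` and equal to `1` at the other sites on it
  set vals : {x : {z // z ∈ ω ∧ inner ℝ n (stereoLift z) + δ = 0} // x ≠ i₁} → ℝ :=
    fun i => if ((i : {z // z ∈ ω ∧ inner ℝ n (stereoLift z) + δ = 0}) : F) = q then 0 else 1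
    with hvals
  obtain ⟨φ, hφ⟩ := LinearMap.exists_extend ((Module.Basis.span hli).constr ℝ vals)
  have hφv : ∀ i : {x : {z // z ∈ ω ∧ inner ℝ n (stereoLift z) + δ = 0} // x ≠ i₁},
      φ (stereoLift ((i : {z // z ∈ ω ∧ inner ℝ n (stereoLift z) + δ = 0}) : F) - stereoLift p) =
        vals i := by
    intro i
    have h1 := LinearMap.congr_fun hφ (Module.Basis.span hli i)
    rw [LinearMap.comp_apply, Module.Basis.constr_basis, Submodule.subtype_apply,
      Module.Basis.coe_span_apply] at h1
    exact h1
  -- sites off the hyperplane stay strictly positive for small `ε`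
  obtain ⟨ε, hε, hεpos⟩ := exists_pos_forall_add_mul_pos
    (hfin.subset (sep_subset ω fun z => inner ℝ n (stereoLift z) + δ ≠ 0))
    (fun z => inner ℝ n (stereoLift z) + δ) (fun z => φ (stereoLift z - stereoLift p))
    (fun z hz => (hω z hz.1).lt_of_ne (Ne.symm hz.2))
  -- the perturbed affine function `Φ w = ⟪n, w⟫ + δ + ε φ (w - 𝓛 p)` and the exposing functional
  set L : WithLp 2 (F × ℝ) →ₗ[ℝ] ℝ := innerₗ (WithLp 2 (F × ℝ)) n + ε • φ with hL
  set Φ : WithLp 2 (F × ℝ) →ᵃ[ℝ] ℝ :=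
    L.toAffineMap + AffineMap.const ℝ (WithLp 2 (F × ℝ)) (δ - ε * φ (stereoLift p)) with hΦ
  have hΦw : ∀ w, Φ w = inner ℝ n w + δ + ε * φ (w - stereoLift p) := fun w => by
    simp only [hΦ, hL, AffineMap.coe_add, AffineMap.coe_const, Pi.add_apply, Function.const_apply,
      LinearMap.coe_toAffineMap, LinearMap.add_apply, LinearMap.smul_apply, innerₗ_apply_apply,
      smul_eq_mul, map_sub]
    ring
  set l : StrongDual ℝ (WithLp 2 (F × ℝ)) := -LinearMap.toContinuousLinearMap L with hl
  have hlw : ∀ w, l w = -(Φ w) + (δ - ε * φ (stereoLift p)) := fun w => by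
    rw [hΦw, hl, neg_apply, LinearMap.coe_toContinuousLinearMap', hL,
      LinearMap.add_apply, LinearMap.smul_apply, innerₗ_apply_apply, smul_eq_mul, map_sub]
    ring
  -- values of `Φ` on the lifted sites
  have hΦp : Φ (stereoLift p) = 0 := by rw [hΦw, sub_self, map_zero, mul_zero, add_zero, hP]
  have hΦsite : ∀ z ∈ ω, 0 ≤ Φ (stereoLift z) ∧ (Φ (stereoLift z) = 0 ↔ z = p ∨ z = q) := by
    intro z hz
    by_cases hH : inner ℝ n (stereoLift z) + δ = 0
    · by_cases hzp : z = p
      · subst hzp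
        exact ⟨hΦp.ge, iff_of_true hΦp (Or.inl rfl)⟩
      · have hne : (⟨z, hz, hH⟩ : {z // z ∈ ω ∧ inner ℝ n (stereoLift z) + δ = 0}) ≠ i₁ := by
          rw [hi₁]
          intro h'
          exact hzp (Subtype.mk.inj h')
        have hv := hφv ⟨⟨z, hz, hH⟩, hne⟩
        simp only [hvals] at hv
        rw [hΦw, hH, zero_add, hv]
        by_cases hzq : z = q
        · simp [hzq]
        · simp only [hzq, if_false, mul_one, hzp, false_or, iff_false]
          exact ⟨hε.le, hε.ne'⟩
    · have hpos := hεpos z ⟨hz, hH⟩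
      rw [hΦw]
      refine ⟨hpos.le, iff_of_false hpos.ne' ?_⟩
      rintro (rfl | rfl)
      · exact hH hP
      · exact hH hQ
  have hΦS : ∀ w ∈ stereoLift '' ω, 0 ≤ Φ w := by
    rintro _ ⟨z, hz, rfl⟩
    exact (hΦsite z hz).1
  have hΦA : ∀ x ∈ convexHull ℝ (stereoLift '' ω), 0 ≤ Φ x := fun x hx =>
    (convexHull_min (fun w hw => hΦS w hw) ((convex_Ici (0 : ℝ)).affine_preimage Φ)) hx
  have hzero : {w ∈ stereoLift '' ω | Φ w = 0} = {stereoLift p, stereoLift q} := by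
    ext w
    simp only [mem_setOf_eq, mem_insert_iff, mem_singleton_iff, mem_image]
    constructor
    · rintro ⟨⟨z, hz, rfl⟩, h0⟩
      rcases ((hΦsite z hz).2.1 h0) with rfl | rfl
      · exact Or.inl rfl
      · exact Or.inr rfl
    · rintro (rfl | rfl)
      · exact ⟨⟨p, hp, rfl⟩, (hΦsite p hp).2.2 (Or.inl rfl)⟩
      · exact ⟨⟨q, hq, rfl⟩, (hΦsite q hq).2.2 (Or.inr rfl)⟩
  -- the segment is the face cut out by `Φ = 0`, i.e. the set of maximisers of `l`
  refine ⟨l, ?_⟩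
  rw [← convexHull_pair, ← hzero, ← sep_convexHull_eq_convexHull_sep Φ hΦS]
  ext x
  simp only [mem_setOf_eq]
  refine and_congr_right fun hx => ⟨fun h0 y hy => ?_, fun hmax => ?_⟩
  · rw [hlw, hlw, h0]
    linarith [hΦA y hy]
  · have h1 := hmax _ (subset_convexHull ℝ _ ⟨p, hp, rfl⟩)
    rw [hlw, hlw, hΦp] at h1
    linarith [hΦA x hx]

/-- **Brown's theorem, 1-skeleton form (edge ⇒ pencil pair)**, no general position needed: if
`[𝓛 p, 𝓛 q]` is an exposed face of `conv (𝓛 '' ω)` (`p, q ∈ ω`), then `p ~ q` — the exposing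
functional, shifted by its maximum, is a supporting half-space through `𝓛 p`, `𝓛 q`; the degenerate
exposing functional `0` forces `ω ⊆ {p, q}` by strict convexity of the sphere.
[cite: BoissonnatYvinec1998, Thm 17.3.1] -/
theorem isMoebiusDelaunayPair_of_isExposed_segment {ω : Set F} {p q : F} (hp : p ∈ ω) (hq : q ∈ ω)
    (h : IsExposed ℝ (convexHull ℝ (stereoLift '' ω)) (segment ℝ (stereoLift p) (stereoLift q))) :
    IsMoebiusDelaunayPair ω p q := by
  haveI : CompleteSpace (WithLp 2 (F × ℝ)) := FiniteDimensional.complete ℝ _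
  obtain ⟨l, hl⟩ := h ⟨stereoLift p, left_mem_segment ℝ _ _⟩
  have hA : ∀ z ∈ ω, stereoLift z ∈ convexHull ℝ (stereoLift '' ω) := fun z hz =>
    subset_convexHull ℝ _ ⟨z, hz, rfl⟩
  have hPmax : ∀ y ∈ convexHull ℝ (stereoLift '' ω), l y ≤ l (stereoLift p) := by
    have h1 : stereoLift p ∈ segment ℝ (stereoLift p) (stereoLift q) := left_mem_segment ℝ _ _
    rw [hl] at h1
    exact h1.2
  have hQmax : ∀ y ∈ convexHull ℝ (stereoLift '' ω), l y ≤ l (stereoLift q) := by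
    have h1 : stereoLift q ∈ segment ℝ (stereoLift p) (stereoLift q) := right_mem_segment ℝ _ _
    rw [hl] at h1
    exact h1.2
  by_cases hl0 : l = 0
  · -- degenerate functional: the hull is the segment, so `ω ⊆ {p, q}`
    have hsub : convexHull ℝ (stereoLift '' ω) ⊆ segment ℝ (stereoLift p) (stereoLift q) := by
      rw [hl]
      exact fun x hx => ⟨hx, fun y _ => by simp [hl0]⟩
    have hω : ∀ z ∈ ω, z = p ∨ z = q := by
      intro z hz
      by_contra hcon
      simp only [not_or] at hcon
      have hne1 : stereoLift z ≠ stereoLift p := fun h' => hcon.1 (stereoLift_injective h')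
      have hne2 : stereoLift z ≠ stereoLift q := fun h' => hcon.2 (stereoLift_injective h')
      have hzseg := hsub (hA z hz)
      rw [← insert_endpoints_openSegment] at hzseg
      have hopen : stereoLift z ∈ openSegment ℝ (stereoLift p) (stereoLift q) := by
        rcases hzseg with h' | h' | h'
        · exact absurd h' hne1
        · exact absurd h' hne2
        · exact h'
      have hpq : stereoLift p ≠ stereoLift q := by
        intro h'
        rw [h', openSegment_same] at hopen
        exact hne2 hopen
      have hlt := openSegment_subset_ball_of_ne
        (mem_closedBall_zero_iff.2 (norm_stereoLift p).le)
        (mem_closedBall_zero_iff.2 (norm_stereoLift q).le) hpq hopen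
      rw [mem_ball_zero_iff, norm_stereoLift] at hlt
      exact lt_irrefl _ hlt
    refine IsDelaunayPair.isMoebiusDelaunayPair
      ⟨midpoint ℝ p q, dist p (midpoint ℝ p q), rfl, ?_, fun z hz => ?_⟩
    · rw [dist_left_midpoint_eq_dist_right_midpoint]
    · rcases hω z hz with rfl | rfl
      · exact le_rfl
      · exact (dist_left_midpoint_eq_dist_right_midpoint _ _).le
  · -- a genuine supporting hyperplane through `𝓛 p`, `𝓛 q`
    set n := (InnerProductSpace.toDual ℝ (WithLp 2 (F × ℝ))).symm l with hn
    have hn0 : n ≠ 0 := by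
      intro h0
      exact hl0 ((InnerProductSpace.toDual ℝ (WithLp 2 (F × ℝ))).symm.map_eq_zero_iff.1 h0)
    have hinner : ∀ w, inner ℝ n w = l w := fun w => InnerProductSpace.toDual_symm_apply
    refine isMoebiusDelaunayPair_iff_stereoLift.2
      ⟨-n, l (stereoLift p), neg_ne_zero.2 hn0, ?_, ?_, fun z hz => ?_⟩
    · rw [inner_neg_left, hinner, neg_add_cancel]
    · rw [inner_neg_left, hinner]
      linarith [hPmax _ (hA q hq), hQmax _ (hA p hp)]
    · rw [inner_neg_left, hinner]
      linarith [hPmax _ (hA z hz)]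

/-- **The Möbius–Delaunay graph of a finite configuration in general position is the 1-skeleton of
the convex hull of its stereographic lift** (Brown 1979): distinct sites are adjacent iff the segment
between their lifts is an exposed face (edge) of the inscribed polytope `conv (𝓛 '' ω)` — which is
how the device graph is computed (`qhull` on the `S³` sample). [cite: Edelsbrunner2001, §5.1] -/
theorem moebiusDelaunayGraph_adj_iff_isExposed {ω : Set F} (hfin : ω.Finite)
    (hgp : SphericalGeneralPosition ω) {p q : ω} :
    (moebiusDelaunayGraph ω).Adj p q ↔ p ≠ q ∧
      IsExposed ℝ (convexHull ℝ (stereoLift '' ω)) (segment ℝ (stereoLift (p : F)) (stereoLift q)) :=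
  and_congr_right fun _ => ⟨fun h => h.isExposed_segment_stereoLift hfin hgp p.2 q.2,
    fun h => isMoebiusDelaunayPair_of_isExposed_segment p.2 q.2 h⟩

end OneSkeleton

/-! ### The ambient-vertex form of the graph -/

/-- The Möbius–Delaunay graph on the ambient vertex type `F` (the signature of the request:
`Adj p q ↔ p ≠ q ∧ p ∈ ω ∧ q ∈ ω ∧ pencil rule`) is Mathlib's `SimpleGraph.spanningCoe` of
`moebiusDelaunayGraph ω`; `SimpleGraph.induce_spanningCoe` recovers the graph on `↥ω`. [folklore] -/
theorem spanningCoe_moebiusDelaunayGraph_adj {ω : Set F} {p q : F} :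
    (moebiusDelaunayGraph ω).spanningCoe.Adj p q ↔
      p ≠ q ∧ p ∈ ω ∧ q ∈ ω ∧ IsMoebiusDelaunayPair ω p q := by
  rw [SimpleGraph.spanningCoe, SimpleGraph.map_adj]
  constructor
  · rintro ⟨p', q', ⟨hne, h⟩, rfl, rfl⟩
    exact ⟨fun h' => hne (Subtype.ext h'), p'.2, q'.2, h⟩
  · rintro ⟨hne, hp, hq, h⟩
    exact ⟨⟨p, hp⟩, ⟨q, hq⟩, ⟨fun h' => hne (congrArg Subtype.val h'), h⟩, rfl, rfl⟩

end Literature.Analysis.FunctionSpaces
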